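import Summits.BirchSwinnertonDyer.BirchSwinnertonDyer.Theorems.ThetaPartnerAtTwoSignedControlAtTwoShaThreeBaseTransferTwo
import Literature.NumberTheory.GaloisRepresentations.CyclicLayerCarry
import HarnessLib

/-!
# K4 `SignedControlAtTwo`, base case of Milne I 4.10 (c)₃ (`hbase`), brick B4 of the (NORM_T) road: the quadratic
# character `ψ_α : Γ_F ↠ ℤ/2` of `F(α)/F`, `α² = a ∈ F`, `α ∉ F`, as a `CyclicCharacter` with kernel `Γ_{F(α)}`

Route `ThetaPartnerAtTwo` (TP2), crux K4 `SignedControlAtTwo` (stmt-BirchSwinnertonDyer-20309), line `eulerchar` v15, stub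
`stub_realThreeOrderTwoBase`; lead `bsd-wall-tp2-p3` g6 (`--supports stmt-BirchSwinnertonDyer-20309`, helper).  Brick B4 of width
seat w2 g7's road `Cruxes/SignedControlAtTwo/HBASE-ROAD-w2g7.md` to (NORM_T): the quadratic character that the tree's cyclic-class
surjectivity `CyclicClassOfResEqZero.exists_eq_cupProduct_δ₀_of_resH_eq_zero` (B5) is fed with, after the quadratic killing (B2) at
the subgroup `galFixing F F(α)` of `…ShaThreeBaseImaginary` (`index_galFixing_adjoin_eq_two`).

For a field `F` of characteristic `0`, `a ∈ F` and `α ∈ F̄` with `α · α = a`, `α ∉ F`: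
* `smul_eq_self_or_eq_neg_of_mul_self` — every `σ ∈ Γ_F` maps `α` to `±α`;
* `exists_smul_ne_of_not_mem_range` — some `σ ∈ Γ_F` moves `α` (`[Γ_F : Γ_{F(α)}] = 2`);
* (w2 g7's `…ShaThreeBaseTransferTwo` supplies `neg_ne_self_of_ne_zero`, `mem_galFixing_adjoin_simple_iff` and the same
  character as a `1`-cocycle of the trivial module `ℤ/2`, `exists_quadraticCocycle`; this file is the `CyclicCharacter` packaging
  that the cyclic-class API (`CyclicClassOfResEqZero`, `CyclicLayerCarry`) consumes.)
* **`exists_cyclicCharacter_two_of_mul_self`** — there is `ψ : CyclicCharacter (absoluteGaloisGroup F) 2` with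
  `ψ σ = 0 ↔ σ • α = α`, `ψ σ = 1 ↔ σ • α = -α`, and `ψ.ker = galFixing F F⟮α⟯`; `smul_eq_of_cyclicCharacter` (`σ • α = ± α`
  read off `ψ σ`).

HONEST FRAMING: THEOREMS ONLY (no definition, no named fact, no `sorry`); elementary Galois theory of a quadratic extension;
closes no item by itself; BSD is not proved by any of this.
References: [NeukirchANT1999] Ch. IV §1; [SerreLocalFields1979] Ch. XIV §1–§2 (the characters `χ_a`).
-/

set_option autoImplicit false
-- the Theorems namespace of this sub repeats the summit name by design (D-0017 nested layout)
set_option linter.dupNamespace false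

noncomputable section

open Function Field
open Literature.NumberTheory.GaloisRepresentations
open Literature.NumberTheory.GaloisRepresentations.LocalWeilDatum

namespace Summit.BirchSwinnertonDyer.BirchSwinnertonDyer.Theorems.SignedEC.ShaThreeBase

section QuadraticCharacter

variable {F : Type} [Field F]

/-- `α ≠ 0` when `α ∉ F` (as `0 ∈ F`). [folklore] -/
theorem ne_zero_of_not_mem_range {α : AlgebraicClosure F} (hαF : α ∉ (algebraMap F (AlgebraicClosure F)).range) :
    α ≠ 0 := by
  rintro rfl
  exact hαF ⟨0, map_zero _⟩

/-- **Every `σ ∈ Γ_F` maps a square root `α` of `a ∈ F` to `±α`**: `(σα)² = σ(a) = a = α²`, so `(σα - α)(σα + α) = 0`.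
[cite: NeukirchANT1999, Ch. IV §1] -/
theorem smul_eq_self_or_eq_neg_of_mul_self (a : F) (α : AlgebraicClosure F) (hα : α * α = algebraMap F _ a)
    (σ : absoluteGaloisGroup F) : σ • α = α ∨ σ • α = -α := by
  have h2 : (σ • α) * (σ • α) = α * α := by
    rw [← smul_mul', hα, smul_algebraMap]
  have h0 : (σ • α - α) * (σ • α + α) = 0 := by
    have : (σ • α - α) * (σ • α + α) = (σ • α) * (σ • α) - α * α := by ring
    rw [this, h2, sub_self]
  rcases mul_eq_zero.1 h0 with h | h
  · exact Or.inl (sub_eq_zero.1 h)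
  · exact Or.inr (eq_neg_of_add_eq_zero_left h)

/-- **Some `σ ∈ Γ_F` moves `α`** (`α² = a`, `α ∉ F`): `Γ_{F(α)}` has index `2` in `Γ_F`
(`index_galFixing_adjoin_eq_two`), so it is a proper subgroup. [cite: NeukirchANT1999, Ch. IV §1] -/
theorem exists_smul_ne_of_not_mem_range [NumberField F] (a : F) (α : AlgebraicClosure F) (hα : α * α = algebraMap F _ a)
    (hαF : α ∉ (algebraMap F (AlgebraicClosure F)).range) : ∃ σ : absoluteGaloisGroup F, σ • α ≠ α := by
  by_contra h
  push Not at h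
  have htop : galFixing F (IntermediateField.adjoin F {α}) = ⊤ := by
    rw [eq_top_iff]
    intro σ _
    rw [mem_galFixing_iff]
    intro y hy
    exact smul_eq_self_of_mem_adjoin F (S := {α}) (fun z hz => by rw [Set.mem_singleton_iff.1 hz]; exact h σ) hy
  have hidx := index_galFixing_adjoin_eq_two a α hα hαF
  rw [htop, Subgroup.index_top] at hidx
  exact absurd hidx (by norm_num)

/-- **The quadratic character `ψ_α : Γ_F ↠ ℤ/2` of `F(α)/F`** (`α² = a ∈ F`, `α ∉ F`, `F` a number field): a
`CyclicCharacter (absoluteGaloisGroup F) 2` with `ψ σ = 0 ↔ σ α = α`, `ψ σ = 1 ↔ σ α = -α`, and kernel `Γ_{F(α)} =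
galFixing F F⟮α⟯` — the character `χ_a` of Kummer theory (Serre XIV §2), continuous because the stabiliser of `α` is open,
onto because `[Γ_F : Γ_{F(α)}] = 2`.  Brick B4 of the (NORM_T) road (fed to `exists_eq_cupProduct_δ₀_of_resH_eq_zero`).
[cite: SerreLocalFields1979, Ch. XIV §2][cite: NeukirchANT1999, Ch. IV §1] -/
theorem exists_cyclicCharacter_two_of_mul_self [NumberField F] (a : F) (α : AlgebraicClosure F)
    (hα : α * α = algebraMap F _ a) (hαF : α ∉ (algebraMap F (AlgebraicClosure F)).range) :
    ∃ ψ : CyclicCharacter (absoluteGaloisGroup F) 2,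
      (∀ σ, ψ σ = 0 ↔ σ • α = α) ∧ (∀ σ, ψ σ = 1 ↔ σ • α = -α) ∧
        ψ.ker = galFixing F (IntermediateField.adjoin F {α}) := by
  classical
  have hα0 : α ≠ 0 := ne_zero_of_not_mem_range hαF
  have hne : -α ≠ α := neg_ne_self_of_ne_zero hα0
  -- the function
  let f : absoluteGaloisGroup F → ZMod 2 := fun σ => if σ • α = α then 0 else 1
  have hf : ∀ σ, f σ = if σ • α = α then 0 else 1 := fun _ => rfl
  have hf0 : ∀ σ, σ • α = α → f σ = 0 := fun σ h => by rw [hf, if_pos h]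
  have hf1 : ∀ σ, σ • α = -α → f σ = 1 := fun σ h => by
    rw [hf, if_neg]
    rw [h]
    exact hne
  have hmul : ∀ σ τ, f (σ * τ) = f σ + f τ := by
    intro σ τ
    rcases smul_eq_self_or_eq_neg_of_mul_self a α hα σ with hσ | hσ <;>
      rcases smul_eq_self_or_eq_neg_of_mul_self a α hα τ with hτ | hτ
    · rw [hf0 _ (by rw [mul_smul, hτ, hσ]), hf0 σ hσ, hf0 τ hτ, add_zero]
    · rw [hf1 _ (by rw [mul_smul, hτ, smul_neg, hσ]), hf0 σ hσ, hf1 τ hτ, zero_add]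
    · rw [hf1 _ (by rw [mul_smul, hτ, hσ]), hf1 σ hσ, hf0 τ hτ, add_zero]
    · rw [hf0 _ (by rw [mul_smul, hτ, smul_neg, hσ, neg_neg]), hf1 σ hσ, hf1 τ hτ]
      decide
  -- local constancy: `f` is constant on the cosets of the open stabiliser of `α`
  have hlc : IsLocallyConstant f := by
    refine (IsLocallyConstant.iff_exists_open _).mpr fun σ => ?_
    refine ⟨(fun x => σ⁻¹ * x) ⁻¹' (MulAction.stabilizer (absoluteGaloisGroup F) α : Set (absoluteGaloisGroup F)),
      (isOpen_stabilizer F α).preimage (by fun_prop), ?_, fun x hx => ?_⟩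
    · change σ⁻¹ * σ ∈ MulAction.stabilizer (absoluteGaloisGroup F) α
      rw [inv_mul_cancel]
      exact one_mem _
    · change σ⁻¹ * x ∈ MulAction.stabilizer (absoluteGaloisGroup F) α at hx
      rw [MulAction.mem_stabilizer_iff, mul_smul, inv_smul_eq_iff] at hx
      -- `x • α = σ • α`
      rw [hf, hf, hx]
  -- surjectivity: an element moving `α`
  obtain ⟨σ₀, hσ₀⟩ := exists_smul_ne_of_not_mem_range a α hα hαF
  have hσ₀' : σ₀ • α = -α := (smul_eq_self_or_eq_neg_of_mul_self a α hα σ₀).resolve_left hσ₀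
  have hsurj : Surjective f := by
    intro b
    fin_cases b
    · exact ⟨1, hf0 1 (one_smul _ _)⟩
    · exact ⟨σ₀, hf1 σ₀ hσ₀'⟩
  let ψ : CyclicCharacter (absoluteGaloisGroup F) 2 :=
    { toFun := f
      map_mul' := hmul
      continuous_toFun := hlc.continuous
      surjective' := hsurj }
  have hψ : ∀ σ, ψ σ = f σ := fun _ => rfl
  have hzero : ∀ σ, ψ σ = 0 ↔ σ • α = α := fun σ => by
    refine ⟨fun h => ?_, fun h => hf0 σ h⟩
    by_contra hc
    have h1 := hf1 σ ((smul_eq_self_or_eq_neg_of_mul_self a α hα σ).resolve_left hc)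
    rw [hψ] at h
    rw [h] at h1
    exact absurd h1 (by decide)
  have hone : ∀ σ, ψ σ = 1 ↔ σ • α = -α := fun σ => by
    refine ⟨fun h => ?_, fun h => hf1 σ h⟩
    rcases smul_eq_self_or_eq_neg_of_mul_self a α hα σ with hσ | hσ
    · have h0 := hf0 σ hσ
      rw [hψ] at h
      rw [h] at h0
      exact absurd h0 (by decide)
    · exact hσ
  refine ⟨ψ, hzero, hone, ?_⟩
  ext σ
  rw [CyclicCharacter.mem_ker, hzero, mem_galFixing_adjoin_simple_iff]

/-- For the quadratic character of `exists_cyclicCharacter_two_of_mul_self`: `σ • α = α` if `ψ σ = 0` and `σ • α = -α`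
otherwise. [cite: SerreLocalFields1979, Ch. XIV §2] -/
theorem smul_eq_of_cyclicCharacter (α : AlgebraicClosure F) (ψ : CyclicCharacter (absoluteGaloisGroup F) 2)
    (h0 : ∀ σ, ψ σ = 0 ↔ σ • α = α) (h1 : ∀ σ, ψ σ = 1 ↔ σ • α = -α) (σ : absoluteGaloisGroup F) :
    σ • α = if ψ σ = 0 then α else -α := by
  by_cases h : ψ σ = 0
  · rw [if_pos h]
    exact (h0 σ).1 h
  · rw [if_neg h]
    refine (h1 σ).1 ?_
    have : ∀ z : ZMod 2, z ≠ 0 → z = 1 := by decide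
    exact this _ h

end QuadraticCharacter

end Summit.BirchSwinnertonDyer.BirchSwinnertonDyer.Theorems.SignedEC.ShaThreeBase

end
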